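import Literature.AnabelianGeometry.EtaleTheta.Discharge.Sec1Rmk131ModelChiThetaData
import Literature.AnabelianGeometry.EtaleTheta.KummerContH1Divisible
import HarnessLib

/-!
# [EtTh] Prop. 1.5 (i)/(ii) at the χ-model: `log(U)` and `log(Ü)` are PRIMITIVE — not proper powers, even modulo
# the Kummer classes (the model content of «`F¹/F² = Ẑ · log(U)`», «`F̈¹/F̈² = Ẑ · log(Ü)`»; F-2502/F-2503, proof-only)

S. Mochizuki, *The étale theta function …*, Publ. RIMS **45** (2009) [EtTh], §1, Prop. 1.5 (i), (ii), PRIMS PDF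
p. 23: "`F¹/F² = Ẑ · log(U)`", "`F² = H¹(G_K, Δ_Θ) →̃ (K^×)^∧`", "`F̈¹/F̈² = Ẑ · log(Ü)`", "`log(Ü) = ½ · log(U)`"
[cite: MochizukiEtTh2009, Prop 1.5 p.23].

PROOF-ONLY companion (abc-iut cell, block F, seat abc-iut-f-117 gen 4; instance-form CONTENT for the FACT-LIST rows
F-2502 `ThetaSetting.Prop15i` / F-2503 `ThetaSetting.Prop15ii` at the named datum `kummerDataχ`; no `def`, no
instance, no Prop fact).  Print's `F¹/F² = Ẑ · log(U)` says in particular that the class of `log(U)` modulo the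
Kummer classes `F²` is NOT DIVISIBLE (a generator of a copy of `Ẑ`).  At abc-iut-L2-t1's `ThetaSetting.modelχ p` with
abc-iut-w5-d171's `kummerDataχ` this indivisibility is a kernel theorem, by the same one-line evaluation as the
`½`-obstruction of `Sec1Rmk131ModelChiNoHalf.lean` (the case `n = 2`), now for every exponent `n ≥ 2`:

* `SettingModel.logUχ_mul_kumY_not_pow` — **`log(U) · κ(u)` is not an `n`-th power in `H¹((Π^tp_Y)^Θ, Δ_Θ)` for any
  `n ≥ 2` and any Kummer class `κ(u)`** (at the geometric element `b ∈ Π^tp_Y`: an `n`-th root `z` would give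
  `z(b)ⁿ = c`, i.e. `ι(1) ∈ nẐ`, refuted mod `n`); `logUχ_not_pow` (`u = 1`);
* `SettingModel.logUddχ_mul_kumYdd_not_pow` — **`log(Ü) · κ̈(u)` is not an `n`-th power in `H¹((Π^tp_Ÿ)^Θ, Δ_Θ)`**
  (`n ≥ 2`; evaluate at `b² ∈ Π^tp_Ÿ`, where `log(Ü) ↦ c`); `logUddχ_not_pow`.

* appended: `logUχ_pow_eq_kumY_imp` / `logUχ_zpow_mem_range_kumY_imp` — **`Ẑ·log(U) ∩ F² = 1`** (no power
  `log(U)ᵏ`, `k ≠ 0`, is a Kummer class: the `Y`-twin of abc-iut-f-139's `logUddχ_zpow_eq_kumYdd_imp`), and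
  `logUddχ_pow_eq_kumYdd_imp`; summary `logUχ_infinite_order_and_primitive_mod_kumY`.

Bricks: `ContH1.mk_pow` (the tree's, `KummerContH1Divisible.lean`), `SettingModel.modN_pow_eq_one` (`x ↦ xⁿ` dies mod `n` in `Ẑ`),
`pow_ne_iotaZ_one` (`ι(1)` is not an `n`-th power, `n ≥ 2`), `pow_ne_deltaThetaCoordχ_iotaZ_one` (`c` is not an
`n`-th power in `Δ_Θ ≅ Ẑ`); the vanishing of Kummer cocycles of constants at geometric elements is
`KummerCore.kummerContMap_apply_eq_one` (`Sec1Rmk131ModelChiThetaData.lean`).  HONEST FRAMING: semi-synthetic model,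
consistency evidence only (the typed `Prop15i`/`Prop15ii` themselves concern the filtration `F⁰ ⊇ F¹ ⊇ F²` and are not
asserted here); nothing of [EtTh] is asserted; no side is taken on [IUTchIII] Cor. 3.12; typed ≠ proved.
-/

noncomputable section

open Topology

namespace Literature.AnabelianGeometry.EtaleTheta

open scoped IsMulCommutative


namespace SettingModel

open Literature.AnabelianGeometry.SemiGraphs ThetaSetting

variable (p : ℕ) [Fact p.Prime]

/-! ### `ι(1)` is not a proper power in `Ẑ`; `c` is not a proper power in `Δ_Θ ≅ Ẑ` -/

/-- `n`-th powers die modulo `n` in `Ẑ`: `modN n (sⁿ) = 1`. [cite: RibesZalesskii2010, Thm 2.7.1] -/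
theorem modN_pow_eq_one (n : ℕ+) (s : ZH) : modN n (s ^ (n : ℕ)) = 1 := by
  rw [map_pow, ← ofAdd_toAdd (modN n s), ← ofAdd_nsmul, nsmul_eq_mul, ZMod.natCast_self, zero_mul, ofAdd_zero]

/-- `ι(1) ∉ nẐ` for `n ≥ 2`: no `s ∈ Ẑ` has `sⁿ = ι(1)` (reduce mod `n`). [cite: RibesZalesskii2010, Thm 2.7.1] -/
theorem pow_ne_iotaZ_one {n : ℕ} (hn : 2 ≤ n) (s : ZH) : s ^ n ≠ iotaZ (Multiplicative.ofAdd 1) := by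
  intro h
  set N : ℕ+ := ⟨n, by omega⟩
  have h1 : modN N (s ^ (N : ℕ)) = modN N (iotaZ (Multiplicative.ofAdd 1)) := congrArg (modN N) h
  rw [modN_pow_eq_one, modN_iotaZ, toAdd_ofAdd, Int.cast_one] at h1
  haveI : Fact (1 < (N : ℕ)) := ⟨show 1 < n by omega⟩
  exact one_ne_zero (ofAdd_eq_one.mp h1.symm)

/-- In `Δ_Θ(modelχ) ≅ Ẑ`: no element has `n`-th power `c = c^{ι(1)}` (`n ≥ 2`). [cite: MochizukiEtTh2009, §1 p.12] -/
theorem pow_ne_deltaThetaCoordχ_iotaZ_one {n : ℕ} (hn : 2 ≤ n) (d : (CurveTheta.thetaToEll (curveχ p)).ker) :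
    d ^ n ≠ deltaThetaCoordχ p (iotaZ (Multiplicative.ofAdd 1)) := by
  obtain ⟨s, rfl⟩ := (bijective_deltaThetaCoordχ p).2 d
  rw [← map_pow]
  exact fun h => pow_ne_iotaZ_one hn s ((bijective_deltaThetaCoordχ p).1 h)

/-! ### `log(U)` is primitive over `Y`, modulo Kummer classes -/

/-- **`log(U) · w` is not an `n`-th power over `Y` (`n ≥ 2`)** for every class `w = [g]` whose cocycle vanishes at the
geometric element `b = (b, 0) ⋊ 1 ∈ Π^tp_Y`. [cite: MochizukiEtTh2009, Prop 1.5 p.23] -/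
theorem logUχ_mul_mk_not_pow {n : ℕ} (hn : 2 ≤ n)
    (g : ↥((ThetaSetting.modelχ p).GtpY.map (ThetaSetting.modelχ p).toTheta) → (ThetaSetting.modelχ p).DeltaTheta)
    (hg : g ∈ contCocycles (MonoidHom.id (ThetaSetting.modelχ p).GtpTheta) (ThetaSetting.modelχ p).DeltaTheta
      ((ThetaSetting.modelχ p).GtpY.map (ThetaSetting.modelχ p).toTheta))
    (hgx : g ⟨_, toTheta_inl_b_mem_gtpY_map p⟩ = 1)
    (z : (ThetaSetting.modelχ p).H1Theta ((ThetaSetting.modelχ p).GtpY.map (ThetaSetting.modelχ p).toTheta)) :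
    z ^ n ≠ logUχ p * ContH1.mk g hg := by
  obtain ⟨f, hf, rfl⟩ := ContH1.exists_mk_eq z
  intro h
  rw [ContH1.mk_pow, logUχ, ContH1.mk_mul_mk] at h
  have key := ContH1.apply_eq_of_mk_eq_mk_conj h ⟨_, toTheta_inl_b_mem_gtpY_map p⟩ (conjNormal_toTheta_inl_b p)
  erw [Pi.pow_apply, Pi.mul_apply] at key
  erw [logUFunχ_inl_b, hgx, mul_one] at key
  exact pow_ne_deltaThetaCoordχ_iotaZ_one p hn _ key

/-- **`log(U)` is not an `n`-th power in `H¹((Π^tp_Y)^Θ, Δ_Θ)` for any `n ≥ 2`** (primitivity of the generator of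
`F¹/F² ≅ Ẑ`, at the χ-model). [cite: MochizukiEtTh2009, Prop 1.5 p.23] -/
theorem logUχ_not_pow {n : ℕ} (hn : 2 ≤ n)
    (z : (ThetaSetting.modelχ p).H1Theta ((ThetaSetting.modelχ p).GtpY.map (ThetaSetting.modelχ p).toTheta)) :
    z ^ n ≠ logUχ p := by
  intro h
  refine logUχ_mul_mk_not_pow p hn 1 (one_mem _) rfl z ?_
  rw [ContH1.mk_one, mul_one]
  exact h

/-- **`log(U) · κ(u)` is not an `n`-th power over `Y` (`n ≥ 2`) for ANY Kummer class `κ(u)`** of the model's Kummer data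
— `log(U)` stays primitive MODULO `F² = κ((K^×)^∧)`: the model content of «`F¹/F² = Ẑ · log(U)`».
[cite: MochizukiEtTh2009, Prop 1.5 p.23] -/
theorem logUχ_mul_kumY_not_pow {n : ℕ} (hn : 2 ≤ n) (u : ↥(kummerCoreχ p).invY)
    (z : (ThetaSetting.modelχ p).H1Theta ((ThetaSetting.modelχ p).GtpY.map (ThetaSetting.modelχ p).toTheta)) :
    z ^ n ≠ logUχ p * (kummerDataχ p).kumY u := by
  obtain ⟨g, hg, hgeq⟩ := ContH1.exists_mk_eq ((kummerDataχ p).kumY u)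
  rw [← hgeq]
  refine logUχ_mul_mk_not_pow p hn g hg ?_ z
  exact (kummerCoreχ p).apply_eq_one_of_kumY_eq_mk u hgeq.symm ⟨_, toTheta_inl_b_mem_gtpY_map p⟩
    (augTheta_kummerCoreχ_inl_b p) (conjNormal_toTheta_inl_b p)

/-- In particular with `u ∈ K^×`: `log(U) · κ(u)` is not a proper power over `Y`. [cite: MochizukiEtTh2009, Prop 1.5 p.23] -/
theorem logUχ_mul_kumY_toKHat_not_pow {n : ℕ} (hn : 2 ≤ n) (u : (↥(ThetaSetting.modelχ p).K)ˣ)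
    (z : (ThetaSetting.modelχ p).H1Theta ((ThetaSetting.modelχ p).GtpY.map (ThetaSetting.modelχ p).toTheta)) :
    z ^ n ≠ logUχ p * (kummerDataχ p).kumY ((kummerDataχ p).toKHat u) :=
  logUχ_mul_kumY_not_pow p hn _ z

/-! ### `log(Ü)` is primitive over `Ÿ`, modulo Kummer classes -/

/-- The geometric element `b² ∈ Π^tp_Ÿ` centralises `Δ_Θ`. [cite: MochizukiEtTh2009, §1 p.12] -/
theorem conjNormal_toTheta_inl_b_sq (a : (ThetaSetting.modelχ p).DeltaTheta) :
    MulAut.conjNormal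
        ((⟨_, toTheta_inl_b_sq_mem_gtpYdd_map p⟩ :
            ↥((ThetaSetting.modelχ p).GtpYdd.map (ThetaSetting.modelχ p).toTheta)) :
          (ThetaSetting.modelχ p).GtpTheta) a = a :=
  conjNormal_toTheta_eq_self p (SemidirectProduct.right_inl _) a

/-- `augTheta` vanishes at `b²`. [cite: MochizukiEtTh2009, §1 p.12] -/
theorem augTheta_kummerCoreχ_inl_b_sq :
    (kummerCoreχ p).augTheta
        ((⟨_, toTheta_inl_b_sq_mem_gtpYdd_map p⟩ :
            ↥((ThetaSetting.modelχ p).GtpYdd.map (ThetaSetting.modelχ p).toTheta)) :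
          (ThetaSetting.modelχ p).GtpTheta) = 1 :=
  (kummerCoreχ p).augTheta_toTheta _

/-- **`log(Ü) · w` is not an `n`-th power over `Ÿ` (`n ≥ 2`)** for every class `w = [g]` whose cocycle vanishes at
`b² ∈ Π^tp_Ÿ` (where the `log(Ü)`-cocycle is `c^{ŷ(b²)/2} = c`). [cite: MochizukiEtTh2009, Prop 1.5 p.23] -/
theorem logUddχ_mul_mk_not_pow {n : ℕ} (hn : 2 ≤ n)
    (g : ↥((ThetaSetting.modelχ p).GtpYdd.map (ThetaSetting.modelχ p).toTheta) → (ThetaSetting.modelχ p).DeltaTheta)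
    (hg : g ∈ contCocycles (MonoidHom.id (ThetaSetting.modelχ p).GtpTheta) (ThetaSetting.modelχ p).DeltaTheta
      ((ThetaSetting.modelχ p).GtpYdd.map (ThetaSetting.modelχ p).toTheta))
    (hgx : g ⟨_, toTheta_inl_b_sq_mem_gtpYdd_map p⟩ = 1)
    (z : (ThetaSetting.modelχ p).H1Theta ((ThetaSetting.modelχ p).GtpYdd.map (ThetaSetting.modelχ p).toTheta)) :
    z ^ n ≠ logUddχ p * ContH1.mk g hg := by
  obtain ⟨f, hf, rfl⟩ := ContH1.exists_mk_eq z
  intro h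
  rw [ContH1.mk_pow, logUddχ, ContH1.mk_mul_mk] at h
  have key := ContH1.apply_eq_of_mk_eq_mk_conj h ⟨_, toTheta_inl_b_sq_mem_gtpYdd_map p⟩
    (conjNormal_toTheta_inl_b_sq p)
  erw [Pi.pow_apply, Pi.mul_apply] at key
  erw [logUddFunχ_inl_b_sq, hgx, mul_one] at key
  exact pow_ne_deltaThetaCoordχ_iotaZ_one p hn _ key

/-- **`log(Ü)` is not an `n`-th power in `H¹((Π^tp_Ÿ)^Θ, Δ_Θ)` for any `n ≥ 2`** (primitivity of the generator of
`F̈¹/F̈² ≅ Ẑ`, at the χ-model). [cite: MochizukiEtTh2009, Prop 1.5 p.23] -/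
theorem logUddχ_not_pow {n : ℕ} (hn : 2 ≤ n)
    (z : (ThetaSetting.modelχ p).H1Theta ((ThetaSetting.modelχ p).GtpYdd.map (ThetaSetting.modelχ p).toTheta)) :
    z ^ n ≠ logUddχ p := by
  intro h
  refine logUddχ_mul_mk_not_pow p hn 1 (one_mem _) rfl z ?_
  rw [ContH1.mk_one, mul_one]
  exact h

/-- **`log(Ü) · κ̈(u)` is not an `n`-th power over `Ÿ` (`n ≥ 2`) for ANY Kummer class `κ̈(u)`** of the model's Kummer
data — `log(Ü)` stays primitive MODULO `F̈² = κ̈((K̈^×)^∧)`: the model content of «`F̈¹/F̈² = Ẑ · log(Ü)`».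
[cite: MochizukiEtTh2009, Prop 1.5 p.23] -/
theorem logUddχ_mul_kumYdd_not_pow {n : ℕ} (hn : 2 ≤ n) (u : ↥(kummerCoreχ p).invYdd)
    (z : (ThetaSetting.modelχ p).H1Theta ((ThetaSetting.modelχ p).GtpYdd.map (ThetaSetting.modelχ p).toTheta)) :
    z ^ n ≠ logUddχ p * (kummerDataχ p).kumYdd u := by
  obtain ⟨g, hg, hgeq⟩ := ContH1.exists_mk_eq ((kummerDataχ p).kumYdd u)
  rw [← hgeq]
  refine logUddχ_mul_mk_not_pow p hn g hg ?_ z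
  exact (kummerCoreχ p).kummerContMap_apply_eq_one _ u hgeq.symm ⟨_, toTheta_inl_b_sq_mem_gtpYdd_map p⟩
    (augTheta_kummerCoreχ_inl_b_sq p) (conjNormal_toTheta_inl_b_sq p)

/-- In particular with `u ∈ K̈^×`: `log(Ü) · κ̈(u)` is not a proper power over `Ÿ`. [cite: MochizukiEtTh2009, Prop 1.5 p.23] -/
theorem logUddχ_mul_kumYdd_toKddHat_not_pow {n : ℕ} (hn : 2 ≤ n) (u : (↥(ThetaSetting.modelχ p).Kdd)ˣ)
    (z : (ThetaSetting.modelχ p).H1Theta ((ThetaSetting.modelχ p).GtpYdd.map (ThetaSetting.modelχ p).toTheta)) :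
    z ^ n ≠ logUddχ p * (kummerDataχ p).kumYdd ((kummerDataχ p).toKddHat u) :=
  logUddχ_mul_kumYdd_not_pow p hn _ z

/-- Summary at the named Kummer datum: `logU` and `logUdd` of `kummerDataχ` are NOT proper powers.
[cite: MochizukiEtTh2009, Prop 1.5 p.23] -/
theorem kummerDataχ_logU_logUdd_not_pow {n : ℕ} (hn : 2 ≤ n) :
    (∀ z : (ThetaSetting.modelχ p).H1Theta ((ThetaSetting.modelχ p).GtpY.map (ThetaSetting.modelχ p).toTheta),
        z ^ n ≠ (kummerDataχ p).logU) ∧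
      ∀ z : (ThetaSetting.modelχ p).H1Theta ((ThetaSetting.modelχ p).GtpYdd.map (ThetaSetting.modelχ p).toTheta),
        z ^ n ≠ (kummerDataχ p).logUdd :=
  ⟨fun z => logUχ_not_pow p hn z, fun z => logUddχ_not_pow p hn z⟩

/-! ### `Ẑ·log(U) ∩ F² = 1`, `Ẑ·log(Ü) ∩ F̈² = 1` (appended, same seat): no non-trivial power of the coordinate
class is a Kummer class -/

/-- `ι(1)ᵏ ≠ 1` in `Ẑ` for `k ≠ 0` (`Ẑ` is torsion-free, and `ι(1) ≠ 1`). [cite: RibesZalesskii2010, Thm 2.7.1] -/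
theorem iotaZ_one_pow_ne_one {k : ℕ} (hk : k ≠ 0) : iotaZ (Multiplicative.ofAdd 1) ^ k ≠ 1 := fun h =>
  iotaZ_ofAdd_ne_one one_ne_zero
    (Literature.AnabelianGeometry.AbsoluteAnabelian.ZHatCompletion.eq_one_of_pow_eq_one hk h)

/-- **`log(U)ᵏ` (`k ≥ 1`) is NOT a Kummer class over `Y`**: `Ẑ·log(U) ∩ F² = 1` at the χ-model, i.e. the image of
`log(U)` in `F¹/F²` has infinite order (the `Y`-twin of abc-iut-f-139's `logUddχ_zpow_eq_kumYdd_imp`).  At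
`b ∈ Π^tp_Y`: a Kummer cocycle vanishes, `log(U)ᵏ ↦ cᵏ ≠ 1`. [cite: MochizukiEtTh2009, Prop 1.5 p.23] -/
theorem logUχ_pow_eq_kumY_imp {k : ℕ} {a : ↥(kummerCoreχ p).invY}
    (h : (kummerDataχ p).kumY a = logUχ p ^ k) : k = 0 := by
  by_contra hk
  obtain ⟨g, hg, hgeq⟩ := ContH1.exists_mk_eq ((kummerDataχ p).kumY a)
  have hgx : g ⟨_, toTheta_inl_b_mem_gtpY_map p⟩ = 1 :=
    (kummerCoreχ p).apply_eq_one_of_kumY_eq_mk a hgeq.symm ⟨_, toTheta_inl_b_mem_gtpY_map p⟩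
      (augTheta_kummerCoreχ_inl_b p) (conjNormal_toTheta_inl_b p)
  rw [← hgeq, logUχ, ContH1.mk_pow] at h
  have key := ContH1.apply_eq_of_mk_eq_mk_conj h ⟨_, toTheta_inl_b_mem_gtpY_map p⟩ (conjNormal_toTheta_inl_b p)
  erw [hgx, Pi.pow_apply, logUFunχ_inl_b, ← map_pow] at key
  exact iotaZ_one_pow_ne_one hk
    ((bijective_deltaThetaCoordχ p).1 (key.symm.trans (map_one (deltaThetaCoordχ p)).symm))

/-- `ℤ`-power form: `log(U)ᵏ ∈ κ((K^×)^∧)` forces `k = 0`. [cite: MochizukiEtTh2009, Prop 1.5 p.23] -/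
theorem logUχ_zpow_mem_range_kumY_imp {k : ℤ} (h : logUχ p ^ k ∈ Set.range (kummerDataχ p).kumY) : k = 0 := by
  obtain ⟨a, ha⟩ := h
  cases k with
  | ofNat n =>
    rw [Int.ofNat_eq_natCast, zpow_natCast] at ha
    have := logUχ_pow_eq_kumY_imp p ha
    subst this
    rfl
  | negSucc n =>
    exfalso
    rw [zpow_negSucc] at ha
    have ha' : (kummerDataχ p).kumY a⁻¹ = logUχ p ^ (n + 1) := by rw [map_inv, ha, inv_inv]
    exact Nat.succ_ne_zero n (logUχ_pow_eq_kumY_imp p ha')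

/-- **`log(Ü)ᵏ` (`k ≥ 1`) is NOT a Kummer class over `Ÿ`**: `Ẑ·log(Ü) ∩ F̈² = 1` at the χ-model (same statement as
abc-iut-f-139's `logUddχ_zpow_eq_kumYdd_imp`, natural-power form, evaluated at `b² ∈ Π^tp_Ÿ` where `log(Ü) ↦ c`).
[cite: MochizukiEtTh2009, Prop 1.5 p.23] -/
theorem logUddχ_pow_eq_kumYdd_imp {k : ℕ} {a : ↥(kummerCoreχ p).invYdd}
    (h : (kummerDataχ p).kumYdd a = logUddχ p ^ k) : k = 0 := by
  by_contra hk
  obtain ⟨g, hg, hgeq⟩ := ContH1.exists_mk_eq ((kummerDataχ p).kumYdd a)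
  have hgx : g ⟨_, toTheta_inl_b_sq_mem_gtpYdd_map p⟩ = 1 :=
    (kummerCoreχ p).kummerContMap_apply_eq_one _ a hgeq.symm ⟨_, toTheta_inl_b_sq_mem_gtpYdd_map p⟩
      (augTheta_kummerCoreχ_inl_b_sq p) (conjNormal_toTheta_inl_b_sq p)
  rw [← hgeq, logUddχ, ContH1.mk_pow] at h
  have key := ContH1.apply_eq_of_mk_eq_mk_conj h ⟨_, toTheta_inl_b_sq_mem_gtpYdd_map p⟩
    (conjNormal_toTheta_inl_b_sq p)
  erw [hgx, Pi.pow_apply, logUddFunχ_inl_b_sq, ← map_pow] at key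
  exact iotaZ_one_pow_ne_one hk
    ((bijective_deltaThetaCoordχ p).1 (key.symm.trans (map_one (deltaThetaCoordχ p)).symm))

/-- Summary, «`F¹/F² = Ẑ·log(U)`» at the χ-model in two clauses: modulo the Kummer classes `F² = κ(K^×)` the class
`log(U)` has INFINITE ORDER and is PRIMITIVE. [cite: MochizukiEtTh2009, Prop 1.5 p.23] -/
theorem logUχ_infinite_order_and_primitive_mod_kumY :
    (∀ (k : ℕ) (a : ↥(kummerCoreχ p).invY), (kummerDataχ p).kumY a = logUχ p ^ k → k = 0) ∧
      ∀ (n : ℕ), 2 ≤ n → ∀ (u : ↥(kummerCoreχ p).invY)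
        (z : (ThetaSetting.modelχ p).H1Theta ((ThetaSetting.modelχ p).GtpY.map (ThetaSetting.modelχ p).toTheta)),
        z ^ n ≠ logUχ p * (kummerDataχ p).kumY u :=
  ⟨fun _ _ h => logUχ_pow_eq_kumY_imp p h, fun _ hn u z => logUχ_mul_kumY_not_pow p hn u z⟩

end SettingModel

end Literature.AnabelianGeometry.EtaleTheta

end
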